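import Mathlib
import HarnessLib
import Literature.Analysis.Calculus.TaylorSegment
import Summits.NavierStokesRegularity.NavierStokesRegularity.Theorems.PoloidalWindowDoorLrcModEntireTwistingTHFlatRidgeJet

/-!
# Item `LrcModEntire` (stmt-NavierStokesRegularity-20428) — THE FLAT RIDGE SUB-CELL, third order: `σv₂(−1,·) − |N|` vanishes to FOURTH order at a flat hot point

LEAD of item 20428 ns-poloidal-K2-p3 g15 (`--supports stmt-NavierStokesRegularity-20428 --as helper`).  Sequel of `…TwistingTHFlatRidgeJet` (the Hessian vanishes at a flat hot
point; memo T2B-g14 §13c / T2B-g15 §15e).  Class-free core: at a GLOBAL maximum `y` of a `C³` function `f` with `D²f(y)[w,w] = 0` the cubic form vanishes, `D³f(y)[w,w,w] = 0`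
(along the line `t ↦ f(y + tw)`: if `g‴(0) ≠ 0` then `g″` has a sign on one side of `0`, so `g′` and then `g` are strictly monotone there and `g` exceeds its maximum).  Binder
corollary: at a flat hot point of a (TH)-column profile, `D³(σv₂(−1,·))(y)[w,w,w] = 0` for every `w` — the odd order `3` is excluded by the sign, so `σv₂(−1,·) − |N|` vanishes to
order `≥ 4` across the flat ridge.

* `iteratedFDeriv_three_diag_eq_zero_of_isMax` — class-free;
* `cubic_eq_zero_of_flatHotPoint` — binder level (clauses of `stub_T2b` VERBATIM + the flat hypothesis of `…FlatRidgeJet.hessian_eq_zero_of_flatHotPoint`).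

WHAT THIS IS NOT: not a claim about Navier–Stokes regularity and not a proof of `stub_T2b`; the flat sub-cell stays OPEN (bears_on LADDER-NS N0, item 20428 / crux 19708; OPEN).
-/

set_option linter.style.longLine false
set_option linter.dupNamespace false

namespace Summit.NavierStokesRegularity.NavierStokesRegularity.Theorems.PoloidalWindowDoorLrcModEntireTwistingTHFlatRidgeCubic

open Set Function Filter Topology Metric
open scoped RealInnerProductSpace InnerProductSpace ContDiff
open Literature.Analysis Literature.Analysis.FluidPDE Literature.Analysis.UnboundedOperators Literature.Analysis.Calculus
open Summit.NavierStokesRegularity.NavierStokesRegularity.Theorems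
open Summit.NavierStokesRegularity.NavierStokesRegularity.Theorems.LocalSineTubeDoorProfileAlignedWindowRigidityAncient
open Summit.NavierStokesRegularity.NavierStokesRegularity.Theorems.PoloidalWindowDoorLrcModEntireTwistingTHFlatRidgeJet

/-- A real function with `h 0 = 0` and `h′(0) = c > 0` is positive just to the right of `0` and negative just to the left. -/
theorem sign_near_of_hasDerivAt_pos {h : ℝ → ℝ} {c : ℝ} (hd : HasDerivAt h c 0) (h0 : h 0 = 0) (hc : 0 < c) :
    ∃ ε > 0, (∀ t ∈ Ioo 0 ε, 0 < h t) ∧ (∀ t ∈ Ioo (-ε) 0, h t < 0) := by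
  have ht := (hasDerivAt_iff_tendsto_slope_zero.1 hd)
  have hev : ∀ᶠ t in 𝓝[≠] (0 : ℝ), c / 2 < t⁻¹ • (h (0 + t) - h 0) := ht.eventually (lt_mem_nhds (by linarith))
  obtain ⟨U, hU, hUev⟩ := Metric.eventually_nhds_iff.1 (eventually_nhdsWithin_iff.1 hev)
  refine ⟨U, hU, fun t ht => ?_, fun t ht => ?_⟩
  · have h1 := hUev (show dist t 0 < U by rw [Real.dist_eq, sub_zero, abs_of_pos ht.1]; exact ht.2) (ne_of_gt ht.1)
    rw [zero_add, h0, sub_zero, smul_eq_mul] at h1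
    have h2 : 0 < t⁻¹ * h t := by linarith
    exact pos_of_mul_pos_right h2 (inv_pos.2 ht.1).le
  · have h1 := hUev (show dist t 0 < U by rw [Real.dist_eq, sub_zero, abs_of_neg ht.2]; linarith [ht.1]) (ne_of_lt ht.2)
    rw [zero_add, h0, sub_zero, smul_eq_mul] at h1
    have h2 : 0 < t⁻¹ * h t := by linarith
    exact neg_of_mul_pos_right h2 (inv_lt_zero.2 ht.2).le

/-- **At a global maximum with a flat direction the cubic form vanishes**: `f ∈ C³`, `f ≤ f y` everywhere, `D²f(y)[w,w] = 0 ⇒ D³f(y)[w,w,w] = 0`. -/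
theorem iteratedFDeriv_three_diag_eq_zero_of_isMax {E : Type*} [NormedAddCommGroup E] [NormedSpace ℝ E] {f : E → ℝ} (hf : ContDiff ℝ 3 f)
    {y : E} (hmax : ∀ x, f x ≤ f y) (w : E) (hD2 : fderiv ℝ (fderiv ℝ f) y w w = 0) :
    fderiv ℝ (fderiv ℝ (fun x => fderiv ℝ f x w)) y w w = 0 := by
  have hf2 : ContDiff ℝ 2 f := hf.of_le (by norm_cast)
  have hfd : Differentiable ℝ f := hf.differentiable (by norm_cast)
  have hgw : ContDiff ℝ 2 (fun x => fderiv ℝ f x w) := (hf.fderiv_right (m := 2) (by norm_cast)).clm_apply contDiff_const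
  have hDfd : ∀ x, DifferentiableAt ℝ (fderiv ℝ f) x := fun x => ((hf2.fderiv_right (m := 1) (by norm_cast)).differentiable one_ne_zero) x
  -- the path and its derivatives
  set g : ℝ → ℝ := fun σ => f (y + σ • w) with hg
  set g1 : ℝ → ℝ := fun σ => fderiv ℝ f (y + σ • w) w with hg1
  set g2 : ℝ → ℝ := fun σ => fderiv ℝ (fderiv ℝ f) (y + σ • w) w w with hg2
  set c : ℝ := fderiv ℝ (fderiv ℝ (fun x => fderiv ℝ f x w)) y w w with hcdef
  have hgd : ∀ σ, HasDerivAt g (g1 σ) σ := fun σ => hasDerivAt_comp_lineSegment hfd y w σ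
  have hg1d : ∀ σ, HasDerivAt g1 (g2 σ) σ := fun σ => hasDerivAt_fderiv_comp_lineSegment hf2 y w σ
  have hg2d : HasDerivAt g2 c 0 := by
    have h := hasDerivAt_fderiv_comp_lineSegment hgw y w 0
    have heq : (fun σ : ℝ => fderiv ℝ (fun x => fderiv ℝ f x w) (y + σ • w) w) = g2 := by
      funext σ; simp only [hg2]; rw [fderiv_clm_apply (hDfd _) (differentiableAt_const w)]; simp
    rw [heq, zero_smul, add_zero] at h
    exact h
  have hg1_0 : g1 0 = 0 := by
    have hloc : IsLocalMax g 0 := Filter.Eventually.of_forall fun σ => by simp only [hg]; simpa using hmax (y + σ • w)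
    have := hloc.hasDerivAt_eq_zero (hgd 0)
    exact this
  have hg2_0 : g2 0 = 0 := by simp only [hg2, zero_smul, add_zero]; exact hD2
  have hg0 : ∀ σ, g σ ≤ g 0 := fun σ => by simp only [hg, zero_smul, add_zero]; exact hmax _
  have hgc : Continuous g := continuous_iff_continuousAt.2 fun σ => (hgd σ).continuousAt
  have hg1c : Continuous g1 := continuous_iff_continuousAt.2 fun σ => (hg1d σ).continuousAt
  -- ## the sign argument
  by_contra hc
  rcases lt_or_gt_of_ne hc with hneg | hpos
  · -- `c < 0`: `g2 > 0` on `(−ε, 0)` ⇒ `g1 < 0` there ⇒ `g` strictly decreasing on `[−ε/2, 0]` ⇒ `g(−ε/2) > g 0`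
    obtain ⟨ε, hε, -, hleft⟩ := sign_near_of_hasDerivAt_pos (h := fun σ => -g2 σ) hg2d.neg (by simp [hg2_0]) (by linarith)
    have hg2pos : ∀ t ∈ Ioo (-ε) 0, 0 < g2 t := fun t ht => by have := hleft t ht; linarith
    have hmono1 : StrictMonoOn g1 (Icc (-ε / 2) 0) :=
      strictMonoOn_of_deriv_pos (convex_Icc _ _) hg1c.continuousOn fun t ht => by
        rw [interior_Icc] at ht
        rw [(hg1d t).deriv]; exact hg2pos t ⟨by linarith [ht.1], ht.2⟩
    have hg1neg : ∀ t ∈ Ioo (-ε / 2) 0, g1 t < 0 := fun t ht => by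
      have := hmono1 ⟨ht.1.le, ht.2.le⟩ ⟨by linarith, le_rfl⟩ ht.2
      rwa [hg1_0] at this
    have hanti : StrictAntiOn g (Icc (-ε / 2) 0) :=
      strictAntiOn_of_deriv_neg (convex_Icc _ _) hgc.continuousOn fun t ht => by
        rw [interior_Icc] at ht
        rw [(hgd t).deriv]; exact hg1neg t ht
    have := hanti ⟨le_rfl, by linarith⟩ ⟨by linarith, le_rfl⟩ (by linarith : -ε / 2 < (0 : ℝ))
    linarith [hg0 (-ε / 2)]
  · -- `c > 0`: `g2 > 0` on `(0, ε)` ⇒ `g1 > 0` there ⇒ `g` strictly increasing on `[0, ε/2]` ⇒ `g(ε/2) > g 0`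
    obtain ⟨ε, hε, hright, -⟩ := sign_near_of_hasDerivAt_pos hg2d hg2_0 hpos
    have hmono1 : StrictMonoOn g1 (Icc 0 (ε / 2)) :=
      strictMonoOn_of_deriv_pos (convex_Icc _ _) hg1c.continuousOn fun t ht => by
        rw [interior_Icc] at ht
        rw [(hg1d t).deriv]; exact hright t ⟨ht.1, by linarith [ht.2]⟩
    have hg1pos : ∀ t ∈ Ioo 0 (ε / 2), 0 < g1 t := fun t ht => by
      have := hmono1 ⟨le_rfl, by linarith⟩ ⟨ht.1.le, ht.2.le⟩ ht.1
      rwa [hg1_0] at this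
    have hmono : StrictMonoOn g (Icc 0 (ε / 2)) :=
      strictMonoOn_of_deriv_pos (convex_Icc _ _) hgc.continuousOn fun t ht => by
        rw [interior_Icc] at ht
        rw [(hgd t).deriv]; exact hg1pos t ht
    have := hmono ⟨le_rfl, by linarith⟩ ⟨by linarith, le_rfl⟩ (by linarith : (0 : ℝ) < ε / 2)
    linarith [hg0 (ε / 2)]

variable {C : ℝ} {v : ℝ → EuclideanSpace ℝ (Fin 3) → EuclideanSpace ℝ (Fin 3)}

/-- **AT A FLAT HOT POINT `σv₂(−1,·) − |N|` VANISHES TO FOURTH ORDER**: the cubic form `D³(σv₂(−1,·))(y)[w,w,w]` vanishes for every `w` (together with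
`…FlatRidgeJet.hessian_eq_zero_of_flatHotPoint`).  Hypotheses = those of `hessian_eq_zero_of_flatHotPoint`. -/
theorem cubic_eq_zero_of_flatHotPoint (hdec : HasTypeITimeDecay C v) (hcont : ContinuousOn (uncurry v) (Iio (0 : ℝ) ×ˢ univ))
    (hmild : ∀ s t : ℝ, s < t → t < 0 → ∀ x, v t x = heatExtension (v s) (t - s) x - oseenDuhamel 1 s v v t x)
    (hdiv : ∀ t < 0, VectorCalculus.IsDivFree (v t))
    (hTH : ∀ t < 0, ∀ x x' : EuclideanSpace ℝ (Fin 3), x 2 = x' 2 → ∀ b c : Fin 3, b ≠ 2 → c ≠ 2 →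
      fderiv ℝ (v t) x (EuclideanSpace.single 2 1) b * fderiv ℝ (v t) x' (EuclideanSpace.single c 1) 2 =
        fderiv ℝ (v t) x' (EuclideanSpace.single 2 1) c * fderiv ℝ (v t) x (EuclideanSpace.single b 1) 2)
    (hne : v (-1) 0 2 ≠ 0) (hhot : ∀ t < 0, ∀ x, Real.sqrt (-t) * |v t x 2| ≤ |v (-1) 0 2|)
    (hproper : ∀ y ∈ {y : EuclideanSpace ℝ (Fin 3) | y 2 = 0 ∧ v (-1) y 2 = v (-1) 0 2}, ∀ r : ℝ, 0 < r →
      ∃ y' : EuclideanSpace ℝ (Fin 3), y' 2 = 0 ∧ dist y' y < r ∧ v (-1) y' 2 ≠ v (-1) 0 2)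
    {σ : ℝ} (hσN : σ * v (-1) 0 2 = |v (-1) 0 2|)
    {y : EuclideanSpace ℝ (Fin 3)} (hy0 : y 2 = 0) (hy : v (-1) y 2 = v (-1) 0 2)
    (hflat : fderiv ℝ (fderiv ℝ (fun x => σ * v (-1) x 2)) y (EuclideanSpace.single 0 1) (EuclideanSpace.single 0 1) +
      fderiv ℝ (fderiv ℝ (fun x => σ * v (-1) x 2)) y (EuclideanSpace.single 1 1) (EuclideanSpace.single 1 1) = 0)
    (w : EuclideanSpace ℝ (Fin 3)) :
    fderiv ℝ (fderiv ℝ (fun x => fderiv ℝ (fun x => σ * v (-1) x 2) x w)) y w w = 0 := by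
  have h1 : (-1 : ℝ) < 0 := by norm_num
  have hσ1 : |σ| = 1 := by
    have h := congrArg abs hσN
    rw [abs_mul, abs_abs] at h
    have hN : 0 < |v (-1) 0 2| := abs_pos.2 hne
    nlinarith
  -- the signed slice is smooth and maximal at `y`
  have hslice_an : AnalyticOnNhd ℝ (v (-1)) univ := analyticOnNhd_slice hcont (bdd_of_hasTypeITimeDecay hdec) hmild h1
  have hθan : AnalyticOnNhd ℝ (fun x => v (-1) x 2) univ := fun x hx =>
    ((EuclideanSpace.proj (𝕜 := ℝ) (2 : Fin 3)).analyticAt _).comp (hslice_an x hx)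
  have hfa : AnalyticOnNhd ℝ (fun x => σ * v (-1) x 2) univ := fun x hx => analyticAt_const.mul (hθan x hx)
  have hf3 : ContDiff ℝ 3 (fun x => σ * v (-1) x 2) := hfa.contDiff.of_le le_top
  have hmax : ∀ x, σ * v (-1) x 2 ≤ σ * v (-1) y 2 := fun x => by
    have h := hhot (-1) h1 x
    rw [neg_neg, Real.sqrt_one, one_mul] at h
    rw [hy]
    calc σ * v (-1) x 2 ≤ |σ * v (-1) x 2| := le_abs_self _
      _ = |v (-1) x 2| := by rw [abs_mul, hσ1, one_mul]
      _ ≤ |v (-1) 0 2| := h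
      _ = σ * v (-1) 0 2 := hσN.symm
  have hD2 := hessian_eq_zero_of_flatHotPoint hdec hcont hmild hdiv hTH hne hhot hproper hσN hy0 hy hflat w w
  exact iteratedFDeriv_three_diag_eq_zero_of_isMax hf3 hmax w hD2

end Summit.NavierStokesRegularity.NavierStokesRegularity.Theorems.PoloidalWindowDoorLrcModEntireTwistingTHFlatRidgeCubic
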